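import Summits.Ventures.AbcShadow.SH27.CurveSide

/-!
# Venture AbcShadow — SH-27 CURVE SIDE: the twist rule at residue degree 2 (PROVED) and singular-class bookkeeping

HONEST FRAMING. Machinery file of the work-bound cell `abc-shadow` (typer seat `abc-shadow-typ-4`, row SH-27); no claim on
abc, on any summit, or on IUT; no Diophantine statement. PROVED here, about the computable definitions of
`SH27/CurveSide.lean`:

* the TWIST RULE `a_𝔮(E_β(λu, λv)) = a_𝔮(E_β(u, v))` for `λ ∈ 𝔽_q^×` at a prime `𝔮 = (q, z² + c₁z + c₀)` of residue degree 2,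
  `q` an odd prime (`curveTrace2_smul`): `a₄`, `a₆` are forms of degree 2, 3 in `(u, v)` (`evalModelZ_A4_smul`,
  `evalModelZ_A6_smul`), so `E_β(λu, λv)` is the quadratic twist by `λ`; in the point count, reindex `x ↦ λx`
  (`smulEquiv`), `(λx)³ + λ²a₄(λx) + λ³a₆ = λ³(x³ + a₄x + a₆)` (`rhsW_smul`), `N(λ³w) = λ⁶N(w)` (`normh_smul`) and
  `(λ⁶n / q) = (n / q)` since `λ^{q−1} = 1` (`legendreZ_mul_pow_six`) — i.e. every `λ ∈ 𝔽_q^×` is a square in `𝔽_{q²}`;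
* hence `mem_of_realisedCheck`: the check `realisedCheck` over the `q + 1` projective classes `(0 : 1)`, `(1 : v)` gives
  `a_𝔮(E_β(u,v)) ∈ R` for EVERY `(u, v) ≢ (0, 0) (mod q)` (used by `SH27/CurveTables.lean`, `SH27/CurveTable29.lean`);
* `NoSingularClass q` ("`γ(u,v) ≢ 0 (mod q)` for `(u,v) ≢ (0,0)`", decidable) and the bookkeeping `intCast_dvd_gammaUV_iff`,
  `zmod_ne_zero_of_isCoprime`, `not_dvd_gammaUV`: for coprime integers `u, v` and such `q`, `q ∤ γ(u, v)`, so `E_β(u,v)`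
  has good reduction above `q` [Che10, Cor 8: the multiplicative primes are those dividing `γ(u,v) = s² − 10st + 5t²`].

ADJACENT (generalized Fermat `(2, 34, 5)`), NOT abc.
-/

namespace Summit.Ventures.AbcShadow
namespace SH27

/-! ## The twist rule at residue degree 2 (proved) -/

section twist
variable {q : ℕ}

/-- `a₄(λu, λv) = λ² · a₄(u, v)` for both models (the monomials of `a₄` have total degree 2). [folklore] -/
theorem evalModelZ_A4_smul (E : CurveTag) (n0 n1 c u v : ZMod q) :
    evalModelZ n0 n1 (modelA4 E) (c * u) (c * v) = c ^ 2 • evalModelZ n0 n1 (modelA4 E) u v := by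
  cases E <;> simp only [modelA4, printedA4, List.map, evalModelZ, List.foldr] <;> ext <;>
    simp only [Prod.fst_add, Prod.snd_add, Prod.smul_fst, Prod.smul_snd, smul_eq_mul, Prod.fst_zero,
      Prod.snd_zero] <;> ring

/-- `a₆(λu, λv) = λ³ · a₆(u, v)` for both models (the monomials of `a₆` have total degree 3). [folklore] -/
theorem evalModelZ_A6_smul (E : CurveTag) (n0 n1 c u v : ZMod q) :
    evalModelZ n0 n1 (modelA6 E) (c * u) (c * v) = c ^ 3 • evalModelZ n0 n1 (modelA6 E) u v := by
  cases E <;> simp only [modelA6, printedA6, List.map, evalModelZ, List.foldr] <;> ext <;>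
    simp only [Prod.fst_add, Prod.snd_add, Prod.smul_fst, Prod.smul_snd, smul_eq_mul, Prod.fst_zero,
      Prod.snd_zero] <;> ring

/-- `(λx)³ + λ²a₄(λx) + λ³a₆ = λ³(x³ + a₄x + a₆)`. [folklore] -/
theorem rhsW_smul (n0 n1 c : ZMod q) (A4 A6 x : F2 q) :
    rhsW n0 n1 (c ^ 2 • A4) (c ^ 3 • A6) (c • x) = c ^ 3 • rhsW n0 n1 A4 A6 x := by
  ext <;> simp only [rhsW, mulh, Prod.fst_add, Prod.snd_add, Prod.smul_fst, Prod.smul_snd, smul_eq_mul] <;> ring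

/-- `N(μw) = μ²N(w)` for `μ ∈ 𝔽_q`. [folklore] -/
theorem normh_smul (c0 n1 m : ZMod q) (w : F2 q) : normh c0 n1 (m • w) = m ^ 2 * normh c0 n1 w := by
  simp only [normh, Prod.smul_fst, Prod.smul_snd, smul_eq_mul]; ring

/-- Euler's criterion with the power taken in `ZMod q`. [folklore] -/
theorem legendreZ_eq [NeZero q] (n : ZMod q) :
    legendreZ q n = if n = 0 then 0 else if n ^ ((q - 1) / 2) = 1 then 1 else -1 := by
  simp only [legendreZ, Nat.cast_pow, ZMod.natCast_zmod_val]

/-- `(λ⁶n / q) = (n / q)` for `λ ≠ 0` (`λ^{6(q−1)/2} = (λ^{q−1})³ = 1`). [folklore] -/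
theorem legendreZ_mul_pow_six [Fact q.Prime] (hq2 : q ≠ 2) (c n : ZMod q) (hc : c ≠ 0) :
    legendreZ q (c ^ 6 * n) = legendreZ q n := by
  rw [legendreZ_eq, legendreZ_eq]
  by_cases hn : n = 0
  · simp [hn]
  · have hcn : c ^ 6 * n ≠ 0 := mul_ne_zero (pow_ne_zero _ hc) hn
    have hodd : 2 * ((q - 1) / 2) = q - 1 := by
      obtain ⟨k, hk⟩ := (Fact.out (p := q.Prime)).odd_of_ne_two hq2
      omega
    have hpow : (c ^ 6 * n) ^ ((q - 1) / 2) = n ^ ((q - 1) / 2) := by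
      rw [mul_pow, ← pow_mul]
      have : c ^ (6 * ((q - 1) / 2)) = 1 := by
        have h3 : 6 * ((q - 1) / 2) = 3 * (q - 1) := by omega
        rw [h3, pow_mul', ZMod.pow_card_sub_one_eq_one hc, one_pow]
      rw [this, one_mul]
    simp only [hcn, hn, if_false, hpow]

/-- Scaling by a nonzero `λ ∈ 𝔽_q` permutes the residue field. [folklore] -/
def smulEquiv [Fact q.Prime] (c : ZMod q) (hc : c ≠ 0) : F2 q ≃ F2 q where
  toFun x := c • x
  invFun x := c⁻¹ • x
  left_inv x := by simp [smul_smul, inv_mul_cancel₀ hc]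
  right_inv x := by simp [smul_smul, mul_inv_cancel₀ hc]

/-- **Twist rule** (trace level): `a_𝔮` of `Y² = X³ + λ²a₄X + λ³a₆` equals `a_𝔮` of `Y² = X³ + a₄X + a₆` over a residue field
of degree 2, for `λ ∈ 𝔽_q^×`. [folklore] -/
theorem traceF2_twist [Fact q.Prime] (hq2 : q ≠ 2) (c0 c1 : ℤ) (A4 A6 : F2 q) (c : ZMod q) (hc : c ≠ 0) :
    traceF2 q c0 c1 (c ^ 2 • A4) (c ^ 3 • A6) = traceF2 q c0 c1 A4 A6 := by
  unfold traceF2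
  congr 1
  rw [← (smulEquiv c hc).sum_comp]
  refine Finset.sum_congr rfl fun x _ => ?_
  show legendreZ q (normh _ _ (rhsW _ _ _ _ (c • x))) = _
  rw [rhsW_smul, normh_smul, ← pow_mul, show 3 * 2 = 6 by rfl, legendreZ_mul_pow_six hq2 c _ hc]

/-- **Twist rule for the Frey family**: `a_𝔮(E_β(λu, λv)) = a_𝔮(E_β(u, v))` at residue degree 2, `λ ∈ 𝔽_q^×`.
[cite: Chen2010, (2), (5), (10) pp.351–357 (a₄, a₆ are forms of degree 2, 3 in (u,v))] -/
theorem curveTrace2_smul [Fact q.Prime] (hq2 : q ≠ 2) (E : CurveTag) (c0 c1 : ℤ) (c u v : ZMod q) (hc : c ≠ 0) :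
    curveTrace2 E q c0 c1 (c * u) (c * v) = curveTrace2 E q c0 c1 u v := by
  unfold curveTrace2
  rw [evalModelZ_A4_smul, evalModelZ_A6_smul, traceF2_twist hq2 c0 c1 _ _ c hc]

end twist

/-! ## Realised trace sets: the check over projective representatives and its meaning -/

/-- The `q + 1` projective representatives `(0, 1)`, `(1, v)` of `𝔽_q² ∖ {0}` modulo `𝔽_q^×`. [folklore] -/
def projReps (q : ℕ) : List (ZMod q × ZMod q) :=
  ((0 : ZMod q), (1 : ZMod q)) :: (List.range q).map (fun n : ℕ => ((1 : ZMod q), ((n : ℕ) : ZMod q)))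

/-- **The realised-set check** (what `decide` evaluates in `SH27/CurveTables.lean`): every projective representative
`(u, v)` has `a_𝔮(E_β(u, v)) ∈ R`. [folklore] -/
def realisedCheck (E : CurveTag) (q : ℕ) [NeZero q] (c0 c1 : ℤ) (R : List ℤ) : Bool :=
  (projReps q).all fun uv => decide (curveTrace2 E q c0 c1 uv.1 uv.2 ∈ R)

/-- **Meaning of the realised-set check**: if it passes then `a_𝔮(E_β(u,v)) ∈ R` for EVERY `(u, v) ∈ 𝔽_q² ∖ {(0,0)}`
(twist rule). [folklore] -/
theorem mem_of_realisedCheck {q : ℕ} [Fact q.Prime] (hq2 : q ≠ 2) {E : CurveTag} {c0 c1 : ℤ} {R : List ℤ}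
    (h : realisedCheck E q c0 c1 R = true) (u v : ZMod q) (huv : (u, v) ≠ (0, 0)) :
    curveTrace2 E q c0 c1 u v ∈ R := by
  have hall : ∀ uv ∈ projReps q, curveTrace2 E q c0 c1 uv.1 uv.2 ∈ R := by
    intro uv huv'
    have := List.all_eq_true.mp h uv huv'
    simpa using this
  by_cases hu : u = 0
  · subst hu
    have hv : v ≠ 0 := by
      rintro rfl
      exact huv rfl
    have key := curveTrace2_smul hq2 E c0 c1 v 0 1 hv
    rw [mul_zero, mul_one] at key
    rw [key]
    exact hall (0, 1) (by simp [projReps])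
  · have key := curveTrace2_smul hq2 E c0 c1 u 1 (u⁻¹ * v) hu
    rw [mul_one, mul_inv_cancel_left₀ hu] at key
    rw [key]
    refine hall (1, u⁻¹ * v) ?_
    have hval : (((u⁻¹ * v).val : ℕ) : ZMod q) = u⁻¹ * v := ZMod.natCast_zmod_val _
    have hmem : ((1 : ZMod q), (((u⁻¹ * v).val : ℕ) : ZMod q)) ∈
        (List.range q).map (fun n : ℕ => ((1 : ZMod q), ((n : ℕ) : ZMod q))) :=
      List.mem_map.mpr ⟨(u⁻¹ * v).val, List.mem_range.mpr (ZMod.val_lt _), rfl⟩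
    rw [hval] at hmem
    exact List.mem_cons_of_mem _ hmem

/-! ## Singular classes and the integers ↔ residues bookkeeping -/

/-- **No singular class mod `q`** (decidable): `γ(u, v) ≢ 0 (mod q)` for every `(u, v) ≢ (0, 0)`; true when `f(q) ≥ 2`
(`γ(u,v) = 0` needs `v²/u² = 5 ± 2√5` in `𝔽_q`). [folklore] -/
def NoSingularClass (q : ℕ) [NeZero q] : Prop := ∀ uv : ZMod q × ZMod q, uv ≠ (0, 0) → gammaZ uv.1 uv.2 ≠ 0

/-- `q ∣ γ(u, v)` iff `γ(ū, v̄) = 0` in `ZMod q`. [folklore] -/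
theorem intCast_dvd_gammaUV_iff (q : ℕ) (u v : ℤ) :
    (q : ℤ) ∣ gammaUV u v ↔ gammaZ (u : ZMod q) (v : ZMod q) = 0 := by
  rw [← ZMod.intCast_zmod_eq_zero_iff_dvd]
  simp [gammaUV, gammaZ]

/-- Coprime integers do not both vanish mod a prime. [folklore] -/
theorem zmod_ne_zero_of_isCoprime {q : ℕ} (hq : q.Prime) {u v : ℤ} (huv : IsCoprime u v) :
    ((u : ZMod q), (v : ZMod q)) ≠ (0, 0) := by
  intro h
  simp only [Prod.mk.injEq, ZMod.intCast_zmod_eq_zero_iff_dvd] at h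
  have hunit : IsUnit (q : ℤ) := huv.isUnit_of_dvd' h.1 h.2
  rcases Int.isUnit_iff.mp hunit with h1 | h1
  · exact hq.one_lt.ne' (by exact_mod_cast h1)
  · have : (0 : ℤ) ≤ q := Int.natCast_nonneg q
    omega

/-- From coprime `u, v` and no singular class mod `q`: `q ∤ γ(u, v)` (so `E_β(u,v)` has GOOD reduction above `q`).
[cite: Chen2010, Cor 8 p.347 (multiplicative primes are those dividing γ)] -/
theorem not_dvd_gammaUV {q : ℕ} [NeZero q] (hq : q.Prime) (hns : NoSingularClass q) {u v : ℤ}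
    (huv : IsCoprime u v) : ¬ (q : ℤ) ∣ gammaUV u v := by
  rw [intCast_dvd_gammaUV_iff]
  exact hns ((u : ZMod q), (v : ZMod q)) (zmod_ne_zero_of_isCoprime hq huv)

end SH27
end Summit.Ventures.AbcShadow
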